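import Summits.QuantumFields.YangMills.Theorems.BalabanUVNodesPortS1ZkGraphSu2
import Summits.QuantumFields.YangMills.Theorems.BalabanUVNodesPortS1Chart
import Summits.QuantumFields.YangMills.Theorems.BalabanUVNodesN07AveragingLocalContinuity

/-!
# NODE O port PT-A — `LQ̃(V^{(k)})` IS 𝔰𝔲(2)-VALUED AT EVERY SMALL-FIELD BACKGROUND: if the (0.4) loop variables of `Vk` lie inside the guard at every coarse bond (`Small expMeanLogSU Vk c`,
# print's «for a set {U_j} of elements close to the identity», p.253), then `recordLQt F k K Vk x c ∈ 𝔰𝔲(2)` for all `x, c` — whether or not `Q̃(Vk, ·)` is differentiable at `0` (if it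
# is, the derivative is a limit of difference quotients of logarithms of `SU(2)` matrices near `1`, which are anti-Hermitian and traceless; if not, it is `0`).  Hence the Z-bridge of
# `…PortS1ZkGraph` at a small background needs only the letter `RecordB0BlockInvertible` and positivity (`recordZkkCan_eq_recordZkkLoc_of_small`)

Cell `ym-nodeO-ideate`, porter seat `ymgap-nodeO-port-PTA-1` (gen 4); `--supports stmt-QuantumFields-27930` (helper).  [I] = [Balaban1987RG1], [B7] = [Balaban1985Averaging].
Uses: N07's `continuousAt_avgFun_apply_of_small` (continuity of the (0.4) average at a small background, ONE coarse bond), `ExpMeanLog.star_mlog_eq_neg` ((22)–(23) p.21: «log of a unitary is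
i·(hermitian)»), `trace_mlog_eq_zero_of_SU2` (✓`…PortS1Chart`), `HasFDerivAt.lim`.
* `continuous_pert`, `continuousAt_recordQt_arg`, `mlog_coe_mem_lieSU_of_norm_le`, ★★ `recordLQt_mem_lieSU_of_small`, ★★ `recordZkkCan_eq_recordZkkLoc_of_small`.

HONEST FRAMING.  Calculus∕linear algebra over the tree's own kernel theorems; NOTHING of Bałaban's estimates asserted∕ported∕discharged; the letter and positivity remain DISPLAYED off the base point;
27930 OPEN; K0⁷∕K-Ax OPEN; NODE O 0∕1; COUNT 8∕28 · K 1∕4 UNMOVED; finite `𝕋⁴_{L^K}` at fixed ε — NOT continuum ∕ OS ∕ Clay; **the Yang–Mills mass gap is NOT proved by any of this.**  No `sorry`,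
no `def`, no `instance`; standard axioms.
-/

noncomputable section

open scoped BigOperators Matrix.Norms.L2Operator Topology

namespace Summit.QuantumFields.YangMills.Theorems.BalabanUVNodesPortS1

open Summit.QuantumFields.YangMills.Theorems.K0RecordFormatNames
open Summit.QuantumFields.YangMills.BalabanUVNodes.N07AveragingLocalContinuity (continuousAt_avgFun_apply_of_small)
open Literature.MathematicalPhysics.QuantumFieldTheory.Balaban1983to89
open Literature.MathematicalPhysics.QuantumFieldTheory.Balaban1983to89.Node00
open Literature.MathematicalPhysics.QuantumFieldTheory.Balaban1983to89.T4Continuum (T4Family)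
open Literature.MathematicalPhysics.QuantumFieldTheory.Balaban1983to89.BlockAveraging (avgFun Small)
open Literature.MathematicalPhysics.QuantumFieldTheory.Balaban1983to89.ExpMeanLog (expMeanLogSU)
open Literature.MathematicalPhysics.QuantumFieldTheory.Balaban1983to89.T4AdjointCovarianceUnitary (lieSU mem_lieSU_iff)
open NormedSpace (exp)
open _root_.Matrix _root_.Filter

variable (F : T4Family)

/-- `x ↦ V′V^{(k)} = exp(B′)·V^{(k)}` is continuous in the coordinates of `B′`. [cite: Balaban1987RG1, (2.4) p.266 (bookkeeping)] -/
theorem continuous_pert (k K : ℕ) (Vk : GaugeField (F.P K) k (SU 2)) : Continuous (pert F k K Vk) := by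
  have hfun : pert F k K Vk = fun x b => (⟨exp (fluctMat F k K x b), exp_fluctMat_mem F k K x b⟩ : SU 2) * Vk b := by
    funext x b
    rw [pert, suOfMat_of_mem (exp_fluctMat_mem F k K x b)]
  letI : NormedAlgebra ℚ (MatA 2) := NormedAlgebra.restrictScalars ℚ ℂ (MatA 2)
  rw [hfun]
  refine continuous_pi fun b => ?_
  refine Continuous.mul ?_ continuous_const
  refine Continuous.subtype_mk ?_ _
  have hlin : Continuous fun x : FluctIdx F k K → ℝ => fluctMat F k K x b := by
    show Continuous fun x : FluctIdx F k K → ℝ => ∑ a, ((x (b, a) : ℝ) : ℂ) • su2Gen a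
    exact continuous_finsetSum _ fun a _ => (Complex.continuous_ofReal.comp (continuous_apply (b, a))).smul continuous_const
  exact NormedSpace.exp_continuous.comp hlin

/-- **The argument of the logarithm in `Q̃` is continuous at `B′ = 0`** at a coarse bond `c` where the background is small: `x ↦ M(V′V^{(k)})(c)·M(V^{(k)})(c)⁻¹` (N07's one-bond continuity of the
(0.4) average at a small background). [cite: Balaban1987RG1, (0.4) p.253, p.267] -/
theorem continuousAt_recordQt_arg (k K : ℕ) (Vk : GaugeField (F.P K) k (SU 2)) (c : PBond (F.P K) (k + 1)) (hsmall : Small expMeanLogSU Vk c) :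
    ContinuousAt (fun x : FluctIdx F k K → ℝ => (avOfRecord F 2 K k).avg (pert F k K Vk x) c * ((avOfRecord F 2 K k).avg Vk c)⁻¹) 0 := by
  refine ContinuousAt.mul ?_ continuousAt_const
  have h1 : ContinuousAt (fun U : GaugeField (F.P K) k (SU 2) => (avOfRecord F 2 K k).avg U c) (pert F k K Vk 0) := by
    have h0 : pert F k K Vk 0 = Vk := pert_zero F k K Vk
    rw [h0]
    exact continuousAt_avgFun_apply_of_small c hsmall
  exact ContinuousAt.comp (g := fun U : GaugeField (F.P K) k (SU 2) => (avOfRecord F 2 K k).avg U c) (f := pert F k K Vk) (x := 0) h1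
    (continuous_pert F k K Vk).continuousAt

/-- **The series logarithm of an `SU(2)` matrix within `⅓` of the unit lies in 𝔰𝔲(2)** (anti-Hermitian: [B7] (22)–(23); traceless: `det = 1`). [cite: Balaban1985Averaging, (22)–(23) p.21] -/
theorem mlog_coe_mem_lieSU_of_norm_le (U : SU 2) (hU : ‖(U : MatA 2) - 1‖ ≤ 1 / 3) : MatrixLog.mlog (U : MatA 2) ∈ lieSU (Fin 2) := by
  rw [mem_lieSU_iff]
  exact ⟨ExpMeanLog.star_mlog_eq_neg (Matrix.mem_specialUnitaryGroup_iff.mp U.2).1 hU, trace_mlog_eq_zero_of_SU2 U (hU.trans (by norm_num))⟩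

/-- ★★ **`LQ̃(V^{(k)})` IS 𝔰𝔲(2)-VALUED AT A SMALL BACKGROUND**: `Small expMeanLogSU Vk c` for every `c` ⟹ `recordLQt F k K Vk x c ∈ 𝔰𝔲(2)` (limit of difference quotients of logarithms of
`SU(2)` matrices near `1` in the closed subspace 𝔰𝔲(2); `0` if `Q̃(Vk, ·)` is not differentiable). [cite: Balaban1987RG1, p.267, (0.4) p.253; Balaban1985Averaging, (22)–(23) p.21] -/
theorem recordLQt_mem_lieSU_of_small (k K : ℕ) (Vk : GaugeField (F.P K) k (SU 2)) (hsmall : ∀ c : PBond (F.P K) (k + 1), Small expMeanLogSU Vk c)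
    (x : FluctIdx F k K → ℝ) (c : PBond (F.P K) (k + 1)) : recordLQt F k K Vk x c ∈ lieSU (Fin 2) := by
  by_cases hd : DifferentiableAt ℝ (recordQt F k K Vk) 0
  · have hf : HasFDerivAt (recordQt F k K Vk) (recordLQt F k K Vk) 0 := by
      simpa [recordLQt] using hd.hasFDerivAt
    -- difference quotients along `r⁻¹ • x`, `r → ∞`
    have hc : Tendsto (fun r : ℝ => ‖r‖) atTop atTop := tendsto_norm_atTop_atTop
    have hlim := hf.lim x hc
    simp only [zero_add] at hlim
    have hlimc : Tendsto (fun r : ℝ => (r • (recordQt F k K Vk (r⁻¹ • x) - recordQt F k K Vk 0)) c) atTop (𝓝 (recordLQt F k K Vk x c)) :=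
      ((continuous_apply c).tendsto _).comp hlim
    -- the argument of the logarithm tends to `1`
    have harg : Tendsto (fun r : ℝ => (((avOfRecord F 2 K k).avg (pert F k K Vk (r⁻¹ • x)) c * ((avOfRecord F 2 K k).avg Vk c)⁻¹ : SU 2) : MatA 2)) atTop (𝓝 1) := by
      have hr : Tendsto (fun r : ℝ => r⁻¹ • x) atTop (𝓝 0) := by
        have h := (tendsto_inv_atTop_zero (𝕜 := ℝ)).smul_const x
        rwa [zero_smul] at h
      have h1 := (continuousAt_recordQt_arg F k K Vk c (hsmall c)).tendsto.comp hr
      have h0 : (avOfRecord F 2 K k).avg (pert F k K Vk 0) c * ((avOfRecord F 2 K k).avg Vk c)⁻¹ = 1 := by rw [pert_zero, mul_inv_cancel]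
      rw [h0] at h1
      have h2 := (continuous_subtype_val.tendsto (1 : SU 2)).comp h1
      simpa [Function.comp_def] using h2
    have hev : ∀ᶠ r : ℝ in atTop, (r • (recordQt F k K Vk (r⁻¹ • x) - recordQt F k K Vk 0)) c ∈ (lieSU (Fin 2) : Set (MatA 2)) := by
      have hnorm : Tendsto (fun r : ℝ => ‖(((avOfRecord F 2 K k).avg (pert F k K Vk (r⁻¹ • x)) c * ((avOfRecord F 2 K k).avg Vk c)⁻¹ : SU 2) : MatA 2) - 1‖) atTop (𝓝 0) := by
        have hsub := harg.sub_const (1 : MatA 2)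
        rw [sub_self] at hsub
        have := (continuous_norm.tendsto (0 : MatA 2)).comp hsub
        simpa [Function.comp_def] using this
      filter_upwards [hnorm.eventually_lt_const (by norm_num : (0 : ℝ) < 1 / 3)] with r hr
      have hQ0 : recordQt F k K Vk 0 = 0 := by
        funext c'
        rw [recordQt, pert_zero, mul_inv_cancel, OneMemClass.coe_one]
        exact MatrixLog.mlog_one
      rw [hQ0, sub_zero, Pi.smul_apply]
      refine Submodule.smul_mem _ r ?_
      exact mlog_coe_mem_lieSU_of_norm_le _ hr.le
    have hclosed : IsClosed ((lieSU (Fin 2) : Submodule ℝ (MatA 2)) : Set (MatA 2)) := Submodule.closed_of_finiteDimensional _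
    exact hclosed.mem_of_tendsto hlimc hev
  · have h0 : recordLQt F k K Vk = 0 := by
      rw [recordLQt]
      exact fderiv_zero_of_not_differentiableAt hd
    rw [h0]
    exact Submodule.zero_mem _

open Classical in
/-- ★★ **THE Z-BRIDGE AT A SMALL BACKGROUND**: standing range, all (0.4) loop variables of `Vk` in the guard, `b₀`-block invertible, `recordPreckLoc` positive definite ⟹
`recordZkkCan = recordZkkLoc` (the displayed `σ` of `…ZkGraph` discharged by `recordLQt_mem_lieSU_of_small`). [cite: Balaban1987RG1, (1.4) p.260, p.267–268, (0.4) p.253] -/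
theorem recordZkkCan_eq_recordZkkLoc_of_small (k K : ℕ) (hk : k + 1 ≤ (F.P K).m + (F.P K).K) (εbg : ℝ) (Vk : GaugeField (F.P K) k (SU 2))
    (hopLin : (PBond (F.P K) (k + 1) → MatA 2) →ₗ[ℝ] (FluctIdx F k K → ℝ)) (hsmall : ∀ c : PBond (F.P K) (k + 1), Small expMeanLogSU Vk c)
    (hA : RecordB0BlockInvertible F k K Vk) (hP : (recordPreckLoc F k K εbg Vk hopLin).PosDef) :
    recordZkkCan F k K εbg Vk hopLin = recordZkkLoc F k K εbg Vk hopLin :=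
  recordZkkCan_eq_recordZkkLoc_of_lieSU F k K hk εbg Vk hopLin hA (recordLQt_mem_lieSU_of_small F k K Vk hsmall) hP

end Summit.QuantumFields.YangMills.Theorems.BalabanUVNodesPortS1

end
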